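import Literature.Analysis.FluidPDE.ClassicalSolutionRescale
import Literature.Analysis.FluidPDE.IsometryInvariance
import Literature.Analysis.FluidPDE.HyperbolicDSSOrbit
import HarnessLib

/-!
# The rescaled Euler–Leray system, the amplitude–time rescaling, and the inverse of the backward
  similarity transform

Analysis/FluidPDE definition file (definitions + proved API; no named facts). Background: a
putative Type-I singularity of Navier–Stokes (`ν = 1`) at `(x, t) = (0, 0)` is studied in the
**backward similarity variables** `y = x/√(−t)`, `s = −log(−t)`,
`u(x, t) = (−t)^{-1/2} U(y, s)`, `p(x, t) = (−t)⁻¹ P(y, s)` — the accepted `lerayOrbit u`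
(`HyperbolicDSSOrbit`) is `U` —, in which Navier–Stokes becomes Leray's time-dependent system
`∂ₛU + ½U + ½(y·∇)U + (U·∇)U − ΔU = −∇P`, `∇·U = 0`, and "the discrete self-similarity
`λu(λx, λ²t) = u(x, t)` is equivalent to the time periodicity `U(·, s) = U(·, s + S₀)`,
`S₀ := 2 log λ`" (Chae–Wolf 2017, §4, proof of Thm. 1.5; Leray 1934, (3.11)–(3.12) for
`s`-independent `U`). Rescaling AMPLITUDE AND TIME by a constant `C > 0`,
`W(σ, y) = C⁻¹ U(σ/C, y)`, `Π(σ, y) = C⁻² P(σ/C, y)`, turns Leray's system into the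
**rescaled Euler–Leray system**

  `∂_σ W + (W·∇)W + ∇Π = ε (ΔW − ½(W + (y·∇)W))`, `∇·W = 0`, `ε = 1/C`,

incompressible Euler perturbed by `ε ×` (viscosity + inverse scaling drift) — the frame of route
`EulerMelnikovDss` of `NavierStokesRegularity` (large Type-I constant `C_* → ∞`). This file
provides the vocabulary requested there (work item `defn-rescaledEulerLerayMonodromy`,
parts (1)–(2); part (3), the linearised monodromy and its Floquet multiplicity, is
`RescaledEulerLerayMonodromy.lean`):

* `IsRescaledEulerLeraySolutionOn S ε W q` / `IsRescaledEulerLeraySolution ε W q` (`S = univ`):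
  **abbreviations** of the accepted `IsClassicalNSSolutionOn S ε f W q` with the drift force
  `f σ y = −(ε/2)(W σ y + DW(σ)(y)[y])` (`rescaledEulerLerayForce`) — reducibly the form inlined by
  the route's items (`isRescaledEulerLeraySolution_iff` is `Iff.rfl`);
* the pressure profile `lerayOrbitPressure p s y = e^{−s} p(−e^{−s}, e^{−s/2} y)` accompanying
  the accepted velocity profile `lerayOrbit`, the **inverse transform**
  `ofLerayOrbit U t x = (√(−t))⁻¹ U(−log(−t), x/√(−t))`, `ofLerayOrbitPressure`, and the inversion
  identities (`ofLerayOrbit_lerayOrbit` for `t < 0`, `lerayOrbit_ofLerayOrbit` for all `s`,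
  `lerayOrbit_eq_iff`);
* `amplitudeRescale C U σ y = C⁻¹ U(σ/C, y)` (the request's `amplitudeRescale`),
  `amplitudeRescalePressure C q σ y = C⁻² q(σ/C, y)`, and
  **`IsClassicalNSSolutionOn.amplitudeRescale_rescaledEulerLeray`**: a solution with parameter `ε`
  is mapped to a solution with parameter `ε/C` on the time set `{σ | σ/C ∈ S}` (`0 < C`; the case
  `α = β = C⁻¹`, `γ = 1` of the accepted `IsClassicalNSSolutionOn.stRescale`); in particular
  Leray's system (`ε = 1`) to the rescaled Euler–Leray system with `ε = C⁻¹`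
  (`amplitudeRescale_leray`);
* periodicity bookkeeping in the route's convention `W (σ + P) (Q y) = Q (W σ y)`:
  `IsRotatedDSS.lerayOrbit_add_period_symm` (a rotated `c`-DSS field has an orbit which is
  `2 log c`-periodic modulo `Q = R⁻¹`; corollary of the accepted `lerayOrbit_add_period`), the
  converse on negative times `isRotatedDSS_neg_of_periodic`, and `amplitudeRescale_periodic`
  (period `P ↦ C P`).

The chain rule "`(u, p)` classical Navier–Stokes solution on `t < 0` ⇔ `(lerayOrbit u,
lerayOrbitPressure p)` solves Leray's system = `IsRescaledEulerLeraySolution 1`" is the sequel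
`RescaledEulerLerayCalculus.lean`.

## Design notes

* Time-first fields `ℝ → E → F` throughout (tree convention); `E` a finite-dimensional real inner
  product space (`ℝ³` in the sources). The inverse maps are total: for `t ≥ 0`, `√(−t) = 0`,
  `(0 : ℝ)⁻¹ = 0` and `Real.log` is junk-extended, so `ofLerayOrbit U t` is the junk field `0` for
  `t > 0`; only `t < 0` is ever used (the rotated-DSS converse is stated on `t < 0` only).
* `σ/C` is spelled `σ / C` and the orbit's `−s/2` is `-s / 2`, so that
  `amplitudeRescale C (lerayOrbit u) σ y` unfolds syntactically to the expression
  `C⁻¹ • (Real.exp (-(σ / C) / 2) • u (-Real.exp (-(σ / C))) (Real.exp (-(σ / C) / 2) • y))`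
  inlined in the route's target (`amplitudeRescale_lerayOrbit_apply` is `rfl`).
* No new solution structure: the rescaled system IS forced Navier–Stokes with viscosity `ε` and a
  `W`-dependent force, so every accepted `IsClassicalNSSolutionOn` tool (isometry conjugation,
  gluing, rescaling, energy identity) applies verbatim; `ε = 0` is `IsClassicalEulerSolutionOn`
  (`isRescaledEulerLeraySolutionOn_zero_iff`).

## Tree / Mathlib search

Tree: `lerayOrbit`, `eq_lerayOrbit_of_neg`, `sqrt_exp_neg`, `IsRotatedDSS.lerayOrbit_add_period`
(`HyperbolicDSSOrbit`, reused); `IsClassicalNSSolutionOn(.stRescale, .congr_force)`, `stPull`,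
`nsRescale`, `IsRotatedDSS`, `lerayBackward` (steady profiles only),
`AlbrittonBrueColombo2022.physVelocity` (forward variables `t > 0`), `simPull` (Bradshaw–Tsai
forward variables) — no inverse backward map, no amplitude rescaling, no rescaled Euler–Leray
abbreviation (`lean search 'ofLerayOrbit|amplitudeRescale|RescaledEulerLeray'`: none). Mathlib:
`Real.exp_log`, `Real.sqrt_eq_iff_eq_sq`, `Real.log_mul`, `Real.log_pow`, `Real.sqrt_mul'`.

## References

* D. Chae, J. Wolf, *Removing discretely self-similar singularities for the 3D Navier–Stokes
  equations*, Comm. PDE 42 (2017) 1359–1374 = arXiv:1610.09464, Def. 1.1 (rotated DSS) and §4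
  (backward similarity transform; DSS ⇔ `2 log λ`-periodicity of the profile).
  [ChaeWolf2017RemovingDSS]
* J. Leray, Acta Math. 63 (1934), §20, (3.11)–(3.12). [Leray1934]
* Z. Bradshaw, T.-P. Tsai, Comm. PDE 42 (2017) = arXiv:1610.05680, §1 (rotated DSS).
  [BradshawTsai2017CPDE]
-/

noncomputable section

open Set Function
open scoped InnerProductSpace

namespace Literature.Analysis.FluidPDE

/-! ### The rescaled Euler–Leray system -/

section System

variable {E : Type*} [NormedAddCommGroup E] [InnerProductSpace ℝ E]

/-- The **drift force** of the rescaled Euler–Leray system with parameter `ε`: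
`f(σ, y) = −(ε/2)(W(σ, y) + DW(σ)(y)[y])`, i.e. `−(ε/2)(W + (y·∇)W)` (Chae–Wolf 2017, §4: the terms
`½U + ½(y·∇)U` of Leray's system, moved to the right-hand side and scaled). [cite: ChaeWolf2017RemovingDSS, §4] -/
def rescaledEulerLerayForce (ε : ℝ) (W : ℝ → E → E) : ℝ → E → E :=
  fun σ y => -((ε / 2) • (W σ y + fderiv ℝ (W σ) y y))

/-- Unfolding `rescaledEulerLerayForce`. [cite: ChaeWolf2017RemovingDSS, §4] -/
@[simp]
theorem rescaledEulerLerayForce_apply (ε : ℝ) (W : ℝ → E → E) (σ : ℝ) (y : E) :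
    rescaledEulerLerayForce ε W σ y = -((ε / 2) • (W σ y + fderiv ℝ (W σ) y y)) := rfl

variable [FiniteDimensional ℝ E]

/-- **Classical solutions of the rescaled Euler–Leray system** with parameter `ε` on the time set
`S`: `∂_σW + (W·∇)W + ∇q = ε(ΔW − ½(W + (y·∇)W))`, `∇·W = 0`, `W`, `q` jointly smooth on `S × E`
— by definition the accepted notion of classical solution of Navier–Stokes with viscosity `ε` and
the drift force `−(ε/2)(W + (y·∇)W)`. For `ε = 1` this is Leray's system in the backward
similarity variables (Chae–Wolf 2017, §4; Leray 1934, (3.11) for steady profiles); `ε = 1/C`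
arises from it by `amplitudeRescale C`; `ε = 0` is incompressible Euler. [cite: ChaeWolf2017RemovingDSS, §4] -/
abbrev IsRescaledEulerLeraySolutionOn (S : Set ℝ) (ε : ℝ) (W : ℝ → E → E) (q : ℝ → E → ℝ) :
    Prop :=
  IsClassicalNSSolutionOn S ε (fun σ y => -((ε / 2) • (W σ y + fderiv ℝ (W σ) y y))) W q

/-- Classical solutions of the rescaled Euler–Leray system on all of `ℝ × E` (the periodic
orbits of the route live on `S = univ`). [cite: ChaeWolf2017RemovingDSS, §4] -/
abbrev IsRescaledEulerLeraySolution (ε : ℝ) (W : ℝ → E → E) (q : ℝ → E → ℝ) : Prop :=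
  IsRescaledEulerLeraySolutionOn univ ε W q

/-- The abbreviation, unfolded to the literal form used by the route's statement items
(definitional). [folklore] -/
theorem isRescaledEulerLeraySolution_iff (ε : ℝ) (W : ℝ → E → E) (q : ℝ → E → ℝ) :
    IsRescaledEulerLeraySolution ε W q ↔
      IsClassicalNSSolutionOn univ ε (fun σ y => -((ε / 2) • (W σ y + fderiv ℝ (W σ) y y))) W q :=
  Iff.rfl

/-- The same with the named drift force. [folklore] -/
theorem isRescaledEulerLeraySolutionOn_iff_force (S : Set ℝ) (ε : ℝ) (W : ℝ → E → E)
    (q : ℝ → E → ℝ) :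
    IsRescaledEulerLeraySolutionOn S ε W q ↔
      IsClassicalNSSolutionOn S ε (rescaledEulerLerayForce ε W) W q :=
  Iff.rfl

/-- For `ε = 0` the rescaled Euler–Leray system is the incompressible Euler system (the drift
force vanishes). [folklore] -/
theorem isRescaledEulerLeraySolutionOn_zero_iff (S : Set ℝ) (W : ℝ → E → E) (q : ℝ → E → ℝ) :
    IsRescaledEulerLeraySolutionOn S 0 W q ↔ IsClassicalEulerSolutionOn S 0 W q := by
  have h0 : (fun (σ : ℝ) (y : E) => -(((0 : ℝ) / 2) • (W σ y + fderiv ℝ (W σ) y y))) = 0 := by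
    funext σ y; simp
  rw [IsRescaledEulerLeraySolutionOn, h0]

end System

/-! ### Backward similarity variables `y = x/√(−t)`, `s = −log(−t)`: pressure and inverse maps -/

section Similarity

variable {E : Type*} [NormedAddCommGroup E] [NormedSpace ℝ E]
variable {F : Type*} [NormedAddCommGroup F] [NormedSpace ℝ F]

/-- The **backward similarity pressure profile** accompanying the accepted velocity profile
`lerayOrbit u s y = e^{−s/2} u(−e^{−s}, e^{−s/2} y)` (`HyperbolicDSSOrbit`):
`lerayOrbitPressure p s y = e^{−s} p(−e^{−s}, e^{−s/2} y)`, i.e. `P = (−t) p` (Chae–Wolf 2017, §4: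
`π(x, t) = (t_* − t)⁻¹ P(y, s)`). [cite: ChaeWolf2017RemovingDSS, §4] -/
def lerayOrbitPressure (p : ℝ → E → ℝ) : ℝ → E → ℝ :=
  fun s y => Real.exp (-s) * p (-Real.exp (-s)) (Real.exp (-s / 2) • y)

/-- **From a backward profile to physical variables**: `u(t, x) = (√(−t))⁻¹ U(−log(−t), x/√(−t))`
for `t < 0` (Chae–Wolf 2017, §4), the inverse of `lerayOrbit` on negative times
(`ofLerayOrbit_lerayOrbit`, `lerayOrbit_ofLerayOrbit`). Junk (`= 0`, as `√(−t) = 0`) for `t > 0`. [cite: ChaeWolf2017RemovingDSS, §4] -/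
def ofLerayOrbit (U : ℝ → E → F) : ℝ → E → F :=
  fun t x => (Real.sqrt (-t))⁻¹ • U (-Real.log (-t)) ((Real.sqrt (-t))⁻¹ • x)

/-- The physical pressure of a pressure profile: `p(t, x) = (−t)⁻¹ P(−log(−t), x/√(−t))`,
`t < 0`. Junk for `t ≥ 0`. [cite: ChaeWolf2017RemovingDSS, §4] -/
def ofLerayOrbitPressure (P : ℝ → E → ℝ) : ℝ → E → ℝ :=
  fun t x => (-t)⁻¹ * P (-Real.log (-t)) ((Real.sqrt (-t))⁻¹ • x)

/-- Unfolding `lerayOrbitPressure`. [cite: ChaeWolf2017RemovingDSS, §4] -/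
@[simp]
theorem lerayOrbitPressure_apply (p : ℝ → E → ℝ) (s : ℝ) (y : E) :
    lerayOrbitPressure p s y = Real.exp (-s) * p (-Real.exp (-s)) (Real.exp (-s / 2) • y) := rfl

/-- Unfolding `ofLerayOrbit`. [cite: ChaeWolf2017RemovingDSS, §4] -/
@[simp]
theorem ofLerayOrbit_apply (U : ℝ → E → F) (t : ℝ) (x : E) :
    ofLerayOrbit U t x = (Real.sqrt (-t))⁻¹ • U (-Real.log (-t)) ((Real.sqrt (-t))⁻¹ • x) := rfl

/-- Unfolding `ofLerayOrbitPressure`. [cite: ChaeWolf2017RemovingDSS, §4] -/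
@[simp]
theorem ofLerayOrbitPressure_apply (P : ℝ → E → ℝ) (t : ℝ) (x : E) :
    ofLerayOrbitPressure P t x = (-t)⁻¹ * P (-Real.log (-t)) ((Real.sqrt (-t))⁻¹ • x) := rfl

/-- `e^{log(−t)/2} = √(−t)` for `t < 0`. [folklore] -/
theorem exp_log_neg_div_two {t : ℝ} (ht : t < 0) :
    Real.exp (Real.log (-t) / 2) = Real.sqrt (-t) := by
  have h0 : 0 < -t := by linarith
  rw [eq_comm, Real.sqrt_eq_iff_eq_sq h0.le (Real.exp_pos _).le, sq, ← Real.exp_add,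
    add_halves, Real.exp_log h0]

/-- **Inversion on negative times**: the physical field of the orbit of `u` is `u` itself for
`t < 0` (Chae–Wolf 2017, §4; the accepted `eq_lerayOrbit_of_neg`, read as an identity of maps). [cite: ChaeWolf2017RemovingDSS, §4] -/
theorem ofLerayOrbit_lerayOrbit (u : ℝ → E → F) {t : ℝ} (ht : t < 0) (x : E) :
    ofLerayOrbit (lerayOrbit u) t x = u t x := by
  rw [ofLerayOrbit_apply, ← eq_lerayOrbit_of_neg u ht x]

/-- The same for the pressure. [cite: ChaeWolf2017RemovingDSS, §4] -/
theorem ofLerayOrbitPressure_lerayOrbitPressure (p : ℝ → E → ℝ) {t : ℝ} (ht : t < 0) (x : E) :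
    ofLerayOrbitPressure (lerayOrbitPressure p) t x = p t x := by
  have h0 : 0 < -t := by linarith
  have hs : 0 < Real.sqrt (-t) := Real.sqrt_pos.2 h0
  simp only [ofLerayOrbitPressure_apply, lerayOrbitPressure_apply, neg_neg,
    exp_log_neg_div_two ht, Real.exp_log h0, smul_smul, mul_inv_cancel₀ hs.ne', one_smul,
    ← mul_assoc, inv_mul_cancel₀ h0.ne', one_mul]

/-- **Inversion, all similarity times**: the orbit of the physical field of `U` is `U`
(Chae–Wolf 2017, §4). [cite: ChaeWolf2017RemovingDSS, §4] -/
theorem lerayOrbit_ofLerayOrbit (U : ℝ → E → F) (s : ℝ) (y : E) :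
    lerayOrbit (ofLerayOrbit U) s y = U s y := by
  have he : 0 < Real.exp (-s / 2) := Real.exp_pos _
  simp only [lerayOrbit_apply, ofLerayOrbit_apply, neg_neg, sqrt_exp_neg, Real.log_exp,
    smul_smul, inv_mul_cancel₀ he.ne', one_smul, mul_inv_cancel₀ he.ne']

/-- The same for the pressure. [cite: ChaeWolf2017RemovingDSS, §4] -/
theorem lerayOrbitPressure_ofLerayOrbitPressure (P : ℝ → E → ℝ) (s : ℝ) (y : E) :
    lerayOrbitPressure (ofLerayOrbitPressure P) s y = P s y := by
  have he : 0 < Real.exp (-s / 2) := Real.exp_pos _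
  have he' : 0 < Real.exp (-s) := Real.exp_pos _
  simp only [lerayOrbitPressure_apply, ofLerayOrbitPressure_apply, neg_neg, sqrt_exp_neg,
    Real.log_exp, smul_smul, inv_mul_cancel₀ he.ne', one_smul, ← mul_assoc,
    mul_inv_cancel₀ he'.ne', one_mul]

/-- On negative times two fields agree iff their orbits agree everywhere. [folklore] -/
theorem lerayOrbit_eq_iff {u v : ℝ → E → F} :
    lerayOrbit u = lerayOrbit v ↔ ∀ t < 0, u t = v t := by
  constructor
  · intro h t ht
    funext x
    rw [← ofLerayOrbit_lerayOrbit u ht x, ← ofLerayOrbit_lerayOrbit v ht x, h]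
  · intro h
    funext s y
    have ht : -Real.exp (-s) < 0 := neg_neg_of_pos (Real.exp_pos _)
    simp only [lerayOrbit_apply, h _ ht]

end Similarity

/-! ### Discrete self-similarity = periodicity of the orbit modulo the isometry -/

section DSS

variable {E : Type*} [NormedAddCommGroup E] [InnerProductSpace ℝ E]

/-- **Rotated DSS ⇒ periodic orbit, in the route's convention.** If `u` is rotated discretely
self-similar with factor `c > 0` and isometry `R` (`c R⁻¹ u(c²t, cRx) = u(t, x)`, Chae–Wolf 2017,
Def. 1.1; Bradshaw–Tsai 2017, §1), then its orbit `U = lerayOrbit u` satisfies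
`U (s + 2 log c) (Q y) = Q (U s y)` with `Q = R⁻¹` — the form `W (σ + P) (Q y) = Q (W σ y)` in which
route `EulerMelnikovDss` states periodicity modulo an isometry (a rewording of the accepted
`IsRotatedDSS.lerayOrbit_add_period`; Chae–Wolf 2017, §4: DSS ⇔ `U(·, s) = U(·, s + 2 log λ)`). [cite: ChaeWolf2017RemovingDSS, Def. 1.1 and §4] -/
theorem IsRotatedDSS.lerayOrbit_add_period_symm {c : ℝ} {R : E ≃ₗᵢ[ℝ] E} {u : ℝ → E → E}
    (h : IsRotatedDSS c R u) (hc : 0 < c) (s : ℝ) (y : E) :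
    lerayOrbit u (s + 2 * Real.log c) (R.symm y) = R.symm (lerayOrbit u s y) := by
  rw [h.lerayOrbit_add_period hc, LinearIsometryEquiv.apply_symm_apply]

/-- **Periodic orbit ⇒ rotated DSS on negative times.** If a profile `U` is `2 log c`-periodic
modulo `Q = R⁻¹`, `U (s + 2 log c) (R⁻¹ y) = R⁻¹ (U s y)`, then its physical field
`u = ofLerayOrbit U` satisfies the rotated-DSS identity `c R⁻¹ u(c²t, cRx) = u(t, x)` for all
`t < 0` (Chae–Wolf 2017, §4, converse direction; the identity at `t ≥ 0` concerns the junk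
extension and is not asserted). [cite: ChaeWolf2017RemovingDSS, Def. 1.1 and §4] -/
theorem isRotatedDSS_neg_of_periodic {c : ℝ} {R : E ≃ₗᵢ[ℝ] E} {U : ℝ → E → E} (hc : 0 < c)
    (hU : ∀ s y, U (s + 2 * Real.log c) (R.symm y) = R.symm (U s y)) {t : ℝ} (ht : t < 0)
    (x : E) :
    c • R.symm (ofLerayOrbit U (c ^ 2 * t) (c • R x)) = ofLerayOrbit U t x := by
  have h0 : 0 < -t := by linarith
  have hc0 : c ≠ 0 := hc.ne'
  have e1 : -(c ^ 2 * t) = c ^ 2 * -t := by ring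
  have e2 : Real.sqrt (c ^ 2 * -t) = c * Real.sqrt (-t) := by
    rw [Real.sqrt_mul' _ h0.le, Real.sqrt_sq hc.le]
  have e3 : -Real.log (c ^ 2 * -t) = -Real.log (-t) - 2 * Real.log c := by
    rw [Real.log_mul (by positivity) h0.ne', Real.log_pow]; push_cast; ring
  set s : ℝ := -Real.log (-t) with hs_def
  have hper := hU (s - 2 * Real.log c) ((Real.sqrt (-t))⁻¹ • R x)
  rw [sub_add_cancel, R.symm.map_smul, LinearIsometryEquiv.symm_apply_apply] at hper
  simp only [ofLerayOrbit_apply, e1, e2, e3, ← hs_def]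
  rw [mul_inv, smul_smul, show c⁻¹ * (Real.sqrt (-t))⁻¹ * c = (Real.sqrt (-t))⁻¹ by
    field_simp, LinearIsometryEquiv.map_smul, ← hper, smul_smul]
  congr 1
  field_simp

end DSS

/-! ### The amplitude–time rescaling `W(σ, y) = C⁻¹ U(σ/C, y)` -/

section Amplitude

variable {E : Type*}
variable {F : Type*} [NormedAddCommGroup F] [NormedSpace ℝ F]

/-- The **amplitude–time rescaling** by `C`: `amplitudeRescale C U σ y = C⁻¹ • U (σ / C) y`
(route `EulerMelnikovDss`: `W(y, σ) = U(y, σ/C_*)/C_*`, `C_*` the Type-I constant; it is the affine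
space–time rescaling `α • stPull β γ 0 0` with `α = β = C⁻¹`, `γ = 1`). Total in `C`
(junk `0 • U 0 y`-free: for `C = 0`, `C⁻¹ = 0` and the value is `0`). [folklore] -/
def amplitudeRescale (C : ℝ) (U : ℝ → E → F) : ℝ → E → F := fun σ y => C⁻¹ • U (σ / C) y

/-- The pressure of the amplitude–time rescaling: `C⁻² q(σ/C, y)`. [folklore] -/
def amplitudeRescalePressure (C : ℝ) (q : ℝ → E → ℝ) : ℝ → E → ℝ :=
  fun σ y => (C⁻¹) ^ 2 * q (σ / C) y

/-- Unfolding `amplitudeRescale`. [folklore] -/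
@[simp]
theorem amplitudeRescale_apply (C : ℝ) (U : ℝ → E → F) (σ : ℝ) (y : E) :
    amplitudeRescale C U σ y = C⁻¹ • U (σ / C) y := rfl

/-- Unfolding `amplitudeRescalePressure`. [folklore] -/
@[simp]
theorem amplitudeRescalePressure_apply (C : ℝ) (q : ℝ → E → ℝ) (σ : ℝ) (y : E) :
    amplitudeRescalePressure C q σ y = (C⁻¹) ^ 2 * q (σ / C) y := rfl

/-- `amplitudeRescale 1` is the identity. [folklore] -/
@[simp]
theorem amplitudeRescale_one (U : ℝ → E → F) : amplitudeRescale 1 U = U := by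
  funext σ y; simp

variable [NormedAddCommGroup E] [InnerProductSpace ℝ E]

/-- The rescaled orbit of the route's target, unfolded (definitional):
`amplitudeRescale C (lerayOrbit u) σ y = C⁻¹ • (e^{−(σ/C)/2} • u (−e^{−σ/C}) (e^{−(σ/C)/2} • y))`. [folklore] -/
theorem amplitudeRescale_lerayOrbit_apply (C : ℝ) (u : ℝ → E → F) (σ : ℝ) (y : E) :
    amplitudeRescale C (lerayOrbit u) σ y =
      C⁻¹ • (Real.exp (-(σ / C) / 2) • u (-Real.exp (-(σ / C))) (Real.exp (-(σ / C) / 2) • y)) :=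
  rfl

/-- Space derivative of a rescaled slice: `D(amplitudeRescale C U σ)(y) = C⁻¹ • DU(σ/C)(y)`
(Mathlib `fderiv_const_smul_field`, unconditional). [folklore] -/
theorem fderiv_amplitudeRescale (C : ℝ) (U : ℝ → E → F) (σ : ℝ) (y : E) :
    fderiv ℝ (amplitudeRescale C U σ) y = C⁻¹ • fderiv ℝ (U (σ / C)) y := by
  rw [show amplitudeRescale C U σ = C⁻¹ • U (σ / C) from rfl, fderiv_const_smul_field, Pi.smul_apply]

/-- **Periodicity modulo an isometry rescales with the time**: if `U (s + P) (Q y) = Q (U s y)`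
for all `s, y`, then `amplitudeRescale C U` has the same property with period `C P` (`C ≠ 0`). [folklore] -/
theorem amplitudeRescale_periodic {C P : ℝ} (hC : C ≠ 0) {Q : E ≃ₗᵢ[ℝ] E} {U : ℝ → E → E}
    (hU : ∀ s y, U (s + P) (Q y) = Q (U s y)) (σ : ℝ) (y : E) :
    amplitudeRescale C U (σ + C * P) (Q y) = Q (amplitudeRescale C U σ y) := by
  simp only [amplitudeRescale_apply]
  rw [show (σ + C * P) / C = σ / C + P by field_simp, hU, LinearIsometryEquiv.map_smul]

variable [FiniteDimensional ℝ E]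

/-- **The amplitude–time rescaling maps parameter `ε` to `ε/C`.** If `(U, q)` is a classical
solution of the rescaled Euler–Leray system with parameter `ε` on the time set `S`, then for
`C > 0` the pair `(C⁻¹ U(σ/C, ·), C⁻² q(σ/C, ·))` is a classical solution with parameter `ε/C` on
`{σ | σ/C ∈ S}`: every term of the system at `(σ, y)` is `C⁻²` times the corresponding term at
`(σ/C, y)`, except that `ε(ΔU − ½(U + y·∇U))` becomes `C⁻¹ · ε(ΔW − ½(W + y·∇W))` (the case
`α = β = C⁻¹`, `γ = 1`, `t₀ = 0`, `x₀ = 0` of the accepted `IsClassicalNSSolutionOn.stRescale`). In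
particular Leray's system (`ε = 1`, Chae–Wolf 2017, §4) is mapped to the rescaled Euler–Leray
system with `ε = 1/C` (route `EulerMelnikovDss`: "`W = U(·, σ/C_*)/C_*` gives EXACTLY
`∂_σW + W·∇W + ∇Π = ε𝓛W`, `ε = 1/C_*`"). [cite: ChaeWolf2017RemovingDSS, §4] -/
theorem IsClassicalNSSolutionOn.amplitudeRescale_rescaledEulerLeray {S : Set ℝ} {ε : ℝ}
    {U : ℝ → E → E} {q : ℝ → E → ℝ} (h : IsRescaledEulerLeraySolutionOn S ε U q) {C : ℝ}
    (hC : 0 < C) :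
    IsRescaledEulerLeraySolutionOn ((fun σ => σ / C) ⁻¹' S) (ε / C) (amplitudeRescale C U)
      (amplitudeRescalePressure C q) := by
  have key := h.stRescale (inv_pos.2 hC) one_pos (mul_one C⁻¹).symm 0 0
  have hS : ((fun r => (0 : ℝ) + C⁻¹ * r) ⁻¹' S) = (fun σ => σ / C) ⁻¹' S := by
    ext r; simp [div_eq_inv_mul]
  have hν : C⁻¹ * ε / 1 = ε / C := by rw [div_one, inv_mul_eq_div]
  have hu : (C⁻¹ • stPull C⁻¹ 1 0 (0 : E) U) = amplitudeRescale C U := by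
    funext t x; simp [stPull_apply, div_eq_inv_mul]
  have hp : ((C⁻¹) ^ 2 • stPull C⁻¹ 1 0 (0 : E) q) = amplitudeRescalePressure C q := by
    funext t x; simp [stPull_apply, div_eq_inv_mul]
  rw [hS, hν, hu, hp] at key
  refine key.congr_force fun σ _ y => ?_
  -- the drift force rescales to the drift force with parameter `ε / C`
  simp only [Pi.smul_apply, stPull_apply, zero_add, one_smul, amplitudeRescale_apply,
    fderiv_amplitudeRescale, FunLike.coe_smul, mul_one]
  rw [show C⁻¹ * σ = σ / C by rw [div_eq_inv_mul], ← smul_add, smul_smul, smul_neg, smul_smul]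
  congr 2
  field_simp

/-- The same on `S = univ`: solutions of the rescaled Euler–Leray system with parameter `ε` on
`ℝ × E` rescale to solutions with parameter `ε/C`, `0 < C`. [cite: ChaeWolf2017RemovingDSS, §4] -/
theorem IsClassicalNSSolutionOn.amplitudeRescale_rescaledEulerLeray_univ {ε : ℝ} {U : ℝ → E → E}
    {q : ℝ → E → ℝ} (h : IsRescaledEulerLeraySolution ε U q) {C : ℝ} (hC : 0 < C) :
    IsRescaledEulerLeraySolution (ε / C) (amplitudeRescale C U) (amplitudeRescalePressure C q) := by
  have := h.amplitudeRescale_rescaledEulerLeray hC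
  rwa [preimage_univ] at this

/-- **Leray's system to the rescaled Euler–Leray system**: a solution `(U, q)` of Leray's system
(`ε = 1`) on `ℝ × E` gives the solution `(C⁻¹U(σ/C, ·), C⁻²q(σ/C, ·))` of the rescaled
Euler–Leray system with `ε = C⁻¹`, `0 < C` (route `EulerMelnikovDss`, `ε = 1/C_*`). [cite: ChaeWolf2017RemovingDSS, §4] -/
theorem IsClassicalNSSolutionOn.amplitudeRescale_leray {U : ℝ → E → E} {q : ℝ → E → ℝ}
    (h : IsRescaledEulerLeraySolution 1 U q) {C : ℝ} (hC : 0 < C) :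
    IsRescaledEulerLeraySolution C⁻¹ (amplitudeRescale C U) (amplitudeRescalePressure C q) := by
  simpa only [one_div] using h.amplitudeRescale_rescaledEulerLeray_univ hC

end Amplitude

end Literature.Analysis.FluidPDE
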